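import Literature.MathematicalPhysics.QuantumFieldTheory.Balaban1983to89.Node00.OpsYSectE
import Literature.MathematicalPhysics.QuantumFieldTheory.Balaban1983to89.B9Thm314WholePair

/-!
# `Balaban1983to89.B9Thm315WholeSectE` — [B9] Theorem 3.15 (p. 432): ROW 24 (`t315`) of the N06 certificate AT THE SECT. E LAYER
# `Node00.operatorLayerYSectE` ∕ `Node00.opsYSectE` (def-Y g4, `Node00.OpsYSectE`) WITH THE BOUND (3.187) PROVED from the pinned
# random-walk slot, a located kernel reading and the walk count

T. Bałaban, *Propagators for lattice gauge theories in a background field*, Commun. Math. Phys. **99** (1985) 389–434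
[`Balaban1985BackgroundPropagators`, "B9"].

statement-level skeleton of published theorems with citation tags; proofs where landed; nothing here is a claim about the Yang–Mills mass gap

THE PRINTED LOCUS (verbatim, p. 432 [PDF 44]).  *"Let us denote a covariance operator of the Gaussian integral in (3.183) by G̃₂, then we
obtain C^{(k)}(Λ) = (I + Dμ)QG̃₂Q*(I + μ*D*). (3.185) … Expanding these into random walks we get a random walk expansion of C^{(k)}(Λ). The
formula (3.185) implies immediately bounds and an exponential decay. Thus we get Theorem 3.15.  For Mα₀ sufficiently small the propagator
C^{(k)}(Λ) is given by the formula (3.185), and satisfies the bound |C^{(k)}(Λ; y, y′)| ≤ B₀e^{−δ₀|y−y′|}, y, y′ ∈ Λ (3.187) with the constants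
B₀, δ₀ depending on d and L only. This propagator has a convergent random walk expansion of the type described previously."*  The «type described
previously» for a KERNEL is Theorem 3.9 (3.98)–(3.99) p. 413: terms indexed by walks ω, |(term)(y, y′)| ≤ O(1)(O(1)M^{−1/2})^{|ω|}M^{−1/2|ω|}
e^{−½δ₀d(ω,y,y′)} (r1's `B9.walkFactor`); p. 410: *"We will use the factor O(M^{−1/2}) to control the sum over random walks ω"* ((3.91): at most
O(1)ⁿ walks of n steps).

THE POINT.  def-Y's `Node00.OpsYSectE` (p498175) constructs the unit-lattice propagator letter `CkY x 𝔏 𝔢 : U ↦ C^{(k)}(Λ; U)` BY ITS DEFINITION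
(3.156)–(3.158) on the index-bond carrier, pins the two Theorem-3.15 slots (`givenBy3185Y` = «C^{(k)}(Λ) equals the (3.185) expression»,
`hasRWExpCY 𝔴` = «the walk letter converges and its terms obey the (3.99)-shape bound on Λ»), and updates the operator layer (`operatorLayerYSectE`,
record level `opsYSectE`, instance of record `opsYOfRecordES`).  ROW 24 of the certificate there is the NAMED binder `t315_opsYOfRecordES_iff`:
the whole printed sentence `B9.Thm315FullPrinted …` — its three conjuncts (3.185), the expansion clause, and THE BOUND (3.187).  THIS FILE proves
the row from SMALLER displayed data, with (3.187) DERIVED: the two pinned slots on the printed prefix (hypotheses on def-Y's letters), ONE located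
reading (def-Y's (O2″): «the kernel of C^{(k)}(Λ; U) is represented by the expansion 𝔴» — print's *"Expanding these into random walks we get a random
walk expansion of C^{(k)}(Λ)"*, read structurally as «limits keep bounds»), the walk count (3.91) and the floor «M sufficiently large».  Generic in
the base layer `ops` and in the letters `𝔏 𝔢 𝔴`, so it serves `opsYOfRecordES` now and any later instance built by `opsYSectE` (def-Y's announced
`opsYOfRecordV4E`) by `rfl`.

* §1 (generic `g B`, `EC : B9.RWKernelExpansion g B`) — `KernelDominated EC Ck inΛ W U` (THE LOCATED READING: for y, y′ ∈ Λ, |Ck(U; y, y′)| is at most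
  EVERY uniform bound of the partial sums Σ_{k<m}Σ_{ω∈W k y y′}|kterm(U; ω; y, y′)| — the kernel twin of `B9Thm314WholeSummation.DominatedBySums`, the
  shape of `B9Thm39Sum.kernel_bound_of_limit`); `kernelDominated_of_tendsto` (the bridge from a genuine kernelwise convergence statement);
  `KWalkCount EC W inΛ dist N₀ D₀ δ δ′` (the (3.91)-type count with explicit constants: Σ_{ω∈W n y y′}e^{−½δd(ω,y,y′)} ≤ N₀D₀ⁿe^{−δ′dist(y,y′)} on Λ);
  `kWalkCount_of_card` (the naive route: card ≤ N₀D₀ⁿ and dist ≤ d(ω)).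
* §2 `half_threshold` («M sufficiently large»: 2D₀c ≤ M ⇒ D₀cM⁻¹ ≤ ½); ★ `kernel_bound_of_reading` — (3.99)-shape term bounds on Λ + the `wlen` law + the
  count + the threshold + the reading ⇒ |Ck(U; y, y′)| ≤ 2N₀C·e^{−δ′dist(y,y′)} (geometric series: `B9Thm314WholeSummation.partialSum_walkFactorS_le`);
  `hasRWExpCY_mono` (the pinned slot is monotone: constants up, rate down, for d(ω) ≥ 0 — `B9Thm314WholePair.walkFactor_mono`); the guard
  `ker_eq_zero_of_kernelDominated_flat` (at def-Y's FLAT walk letter `rwLettersEY_flat` the reading forces the kernel to VANISH on Λ — the located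
  hypothesis has teeth: it is junk-closable only through C^{(k)}(Λ) ≡ 0 on Λ).
* §3 ★★ `thm315FullPrinted_sectE_of_reading` — `B9.Thm315FullPrinted c35Y geo9Y (bg9Y 𝔸 G) (·.Ck) inΛY unitDistY (·.GivenBy3185) (·.HasRWExpC)` AT
  `operatorLayerYSectE 𝔸 G x (ops x) (𝔏 x) (𝔢 x) (𝔴 x)` from: `h` (the two pinned slots on the printed prefix at the expansion's rate δ₁), `hread` (the
  reading at every U where the letter converges), the walk data `W ∕ hW ∕ hwd ∕ hcnt` (rate δ₁ in, δ′ ≤ δ₁ out), uniform term constants `C₀, c₀`, the floor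
  `2D₀c₀ ≤ M⋆`; OUTPUT δ₀ = δ′, a₀, B₀ = 2N₀C₀.  §4 record level: ★★ `t315_opsYSectE_of_reading` (generic `ops 𝔏 𝔢 𝔴`), ★★ `t315_opsYOfRecordES_of_reading`
  (the binder `t315` VERBATIM at `ops := Node00.opsYOfRecordES N θ M⋆ 𝔯 𝔢 𝔴 𝔈`).

HONEST SCOPE.  Count-neutral kernel bookkeeping.  What is PROVED is the summation (3.99) + (3.91) ⇒ (3.187) and the monotonicity of the slot; what
stays DISPLAYED are hypotheses on def-Y's residual letters: the (3.185) identity (print: (3.159)–(3.184) and the positivity γ₀ > 0 of C*Δ_kC, p. 428,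
GAPS G-B9-09∕G-B9-17), the expansion's convergence with its (3.99)-shape bounds (G-B9-10), the reading (O2″) and the walk count.  Nothing of print is
asserted; NOT a node discharge (N06 unmoved), NOT summit progress; one finite lattice programme at fixed ε; nothing continuum ∕ ℝ⁴ ∕ OS ∕ mass gap ∕ Clay.
Cell `pub-ymgap` (D-0062), node N06 [B9], N06-ASSIGNMENT bundle F8 row 24 (successor file, trigger t3′ of the seat's HANDOFF), seat `pub-ymgap-dag-n06-m`
(g4), 2026-08-27.  Imports def-Y's `Node00.OpsYSectE` and the seat's `B9Thm314WholePair` (for `walkFactor_mono` and, through it,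
`B9Thm314WholeSummation`); nothing of either is restated.  Net new unproved facts: 0.
-/

noncomputable section

namespace Literature.MathematicalPhysics.QuantumFieldTheory.Balaban1983to89.B9Thm315WholeSectE

open B9 Node00
open B6KLevelCensusIndexV1 (KIdx)
open B9PinMembersKLevelV1 (MemberY geo9Y bg9Y geo9Y_M mstar_le_M)
open B9PinCarriersKLevelV1 (OperatorLayerY)
open B9PinGeometryKLevelV1 (inΛY unitDistY c35Y unitDistY_nonneg)
open B7Prop2SpecialUnitary (specialUnitaryUnits)
open B9Thm314WholeSummation (partialSum_walkFactorS_le)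
open B9Thm314WholePair (walkFactor_mono)
open B9Thm314 (walkFactorS walkFactor_eq_walkFactorS)

/-! ## §1 The located reading «the kernel is represented by the expansion» and the walk count -/

section Reading

variable {g : Geometry} {B : Backgrounds}

/-- ★ **THE LOCATED READING «C^{(k)}(Λ) has the random walk expansion 𝔴» READ STRUCTURALLY** (p. 432 *"Expanding these into random walks we get a
random walk expansion of C^{(k)}(Λ)"*, Thm 3.9 p. 413 *"can be represented as … (3.98)"*): at `U`, for all `y, y′ ∈ Λ`, the kernel entry
`|Ck(U; y, y′)|` is at most EVERY uniform bound of the partial sums `Σ_{k<m} Σ_{ω ∈ W k y y′} |kterm(U; ω; y, y′)|` over the walk sets — what the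
kernel of a kernelwise convergent operator series satisfies («limits keep bounds», `kernelDominated_of_tendsto`; the kernel twin of
`B9Thm314WholeSummation.DominatedBySums`).  A hypothesis schema on the instance; nothing asserted. [cite: Balaban1985BackgroundPropagators, Thm 3.15 p.432 («a convergent random walk expansion»), Thm 3.9 (3.98) p.413] -/
def KernelDominated (EC : RWKernelExpansion g B) (Ck : SiteKernel g B) (inΛ : g.Site → Prop)
    (W : ℕ → g.Site → g.Site → Finset EC.Walk) (U : B.Cfg) : Prop :=
  ∀ y y' : g.Site, inΛ y → inΛ y' → ∀ b : ℝ,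
    (∀ m : ℕ, ∑ k ∈ Finset.range m, ∑ ω ∈ W k y y', |EC.kterm U ω y y'| ≤ b) → |Ck.ker U y y'| ≤ b

/-- the reading unfolded. [cite: Balaban1985BackgroundPropagators, Thm 3.15 p.432, bookkeeping] -/
theorem kernelDominated_iff (EC : RWKernelExpansion g B) (Ck : SiteKernel g B) (inΛ : g.Site → Prop)
    (W : ℕ → g.Site → g.Site → Finset EC.Walk) (U : B.Cfg) :
    KernelDominated EC Ck inΛ W U ↔ ∀ y y' : g.Site, inΛ y → inΛ y' → ∀ b : ℝ,
      (∀ m : ℕ, ∑ k ∈ Finset.range m, ∑ ω ∈ W k y y', |EC.kterm U ω y y'| ≤ b) → |Ck.ker U y y'| ≤ b := Iff.rfl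

/-- **«Limits keep bounds»** — the bridge from a genuine convergence statement at an instance: if kernel entries `s m y y′` of the partial-sum
operators converge to `Ck(U; y, y′)` for `y, y′ ∈ Λ` and are dominated by the partial sums of the `|kterm|` (subadditivity of the kernel entry),
then `KernelDominated` holds (the shape of `B9Thm39Sum.kernel_bound_of_limit`). [cite: Balaban1985BackgroundPropagators, Thm 3.9 p.413 («convergent in the weighted supremum norm»), bookkeeping] -/
theorem kernelDominated_of_tendsto {EC : RWKernelExpansion g B} {Ck : SiteKernel g B} {inΛ : g.Site → Prop}
    {W : ℕ → g.Site → g.Site → Finset EC.Walk} {U : B.Cfg} (s : ℕ → g.Site → g.Site → ℝ)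
    (hconv : ∀ y y', inΛ y → inΛ y' → Filter.Tendsto (fun m => s m y y') Filter.atTop (nhds (Ck.ker U y y')))
    (hs : ∀ m y y', inΛ y → inΛ y' → |s m y y'| ≤ ∑ k ∈ Finset.range m, ∑ ω ∈ W k y y', |EC.kterm U ω y y'|) :
    KernelDominated EC Ck inΛ W U :=
  fun y y' hy hy' _ hb => le_of_tendsto' ((hconv y y' hy hy').abs) fun m => (hs m y y' hy hy').trans (hb m)

/-- ★ **THE WALK COUNT ON Λ WITH EXPLICIT CONSTANTS** (p. 410 *"We will use the factor O(M^{−1/2}) to control the sum over random walks ω"*, (3.91)):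
`Σ_{ω ∈ W n y y′} e^{−½δd(ω,y,y′)} ≤ N₀·D₀ⁿ·e^{−δ′·dist(y,y′)}` for `y, y′ ∈ Λ` — met by «at most `N₀D₀ⁿ` walks of n steps» with `dist ≤ d(ω)`
(`kWalkCount_of_card`, δ′ = ½δ) or by [4] Lemma 2.1 row sums along the chain (3.93).  A hypothesis schema. [cite: Balaban1985BackgroundPropagators, Cor. 3.8 (3.91)–(3.93) p.410, Thm 3.15 (3.187) p.432] -/
def KWalkCount (EC : RWKernelExpansion g B) (W : ℕ → g.Site → g.Site → Finset EC.Walk) (inΛ : g.Site → Prop)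
    (dist : g.Site → g.Site → ℝ) (N₀ D₀ δ δ' : ℝ) : Prop :=
  ∀ (n : ℕ) (y y' : g.Site), inΛ y → inΛ y' →
    ∑ ω ∈ W n y y', Real.exp (-(δ / 2 * EC.wdist ω y y')) ≤ N₀ * D₀ ^ n * Real.exp (-(δ' * dist y y'))

/-- the count unfolded. [cite: Balaban1985BackgroundPropagators, Cor. 3.8 (3.91) p.410, bookkeeping] -/
theorem kWalkCount_iff (EC : RWKernelExpansion g B) (W : ℕ → g.Site → g.Site → Finset EC.Walk) (inΛ : g.Site → Prop)
    (dist : g.Site → g.Site → ℝ) (N₀ D₀ δ δ' : ℝ) :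
    KWalkCount EC W inΛ dist N₀ D₀ δ δ' ↔ ∀ (n : ℕ) (y y' : g.Site), inΛ y → inΛ y' →
      ∑ ω ∈ W n y y', Real.exp (-(δ / 2 * EC.wdist ω y y')) ≤ N₀ * D₀ ^ n * Real.exp (-(δ' * dist y y')) := Iff.rfl

/-- **THE NAIVE WALK-COUNT ROUTE**: if `card (W n y y′) ≤ N₀·D₀ⁿ` and `dist(y, y′) ≤ d(ω, y, y′)` on the walk sets (the triangle inequality for the
chain distance (3.93)), then `KWalkCount` holds at every rate `δ ≥ 0` with `δ′ = ½δ`. [cite: Balaban1985BackgroundPropagators, Cor. 3.8 (3.91)–(3.93) p.410] -/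
theorem kWalkCount_of_card {EC : RWKernelExpansion g B} (W : ℕ → g.Site → g.Site → Finset EC.Walk) (inΛ : g.Site → Prop)
    (dist : g.Site → g.Site → ℝ) {N₀ D₀ δ : ℝ} (hδ : 0 ≤ δ)
    (hcard : ∀ (n : ℕ) (y y' : g.Site), inΛ y → inΛ y' → ((W n y y').card : ℝ) ≤ N₀ * D₀ ^ n)
    (hdist : ∀ (n : ℕ) (y y' : g.Site) (ω : EC.Walk), ω ∈ W n y y' → dist y y' ≤ EC.wdist ω y y') :
    KWalkCount EC W inΛ dist N₀ D₀ δ (δ / 2) := by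
  intro n y y' hy hy'
  calc ∑ ω ∈ W n y y', Real.exp (-(δ / 2 * EC.wdist ω y y'))
      ≤ ∑ ω ∈ W n y y', Real.exp (-(δ / 2 * dist y y')) :=
        Finset.sum_le_sum fun ω hω =>
          Real.exp_le_exp.2 (neg_le_neg (mul_le_mul_of_nonneg_left (hdist n y y' ω hω) (by positivity)))
    _ = ((W n y y').card : ℝ) * Real.exp (-(δ / 2 * dist y y')) := by rw [Finset.sum_const, nsmul_eq_mul]
    _ ≤ N₀ * D₀ ^ n * Real.exp (-(δ / 2 * dist y y')) := mul_le_mul_of_nonneg_right (hcard n y y' hy hy') (Real.exp_nonneg _)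

end Reading

/-! ## §2 The summation: (3.99)-shape term bounds + the count + the reading ⇒ the kernel bound -/

section Summation

variable {g : Geometry} {B : Backgrounds}

/-- **«for M sufficiently large»**: `2·D₀·c ≤ M` (`M > 0`) gives the ratio `D₀·c·M⁻¹ ≤ ½` of the geometric series over the walk lengths (the
(3.99) step factor `(cM^{−1/2})·M^{−1/2} = cM⁻¹`). [cite: Balaban1985BackgroundPropagators, Thm 3.7 p.409 («for M sufficiently large»), bookkeeping] -/
theorem half_threshold {c D₀ M : ℝ} (hM : 0 < M) (h : 2 * D₀ * c ≤ M) : D₀ * (c * M ^ (-(1 : ℝ))) ≤ 1 / 2 := by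
  rw [Real.rpow_neg_one, ← mul_assoc, ← div_eq_mul_inv, div_le_iff₀ hM]
  linarith

/-- ★ **THE KERNEL BOUND FROM THE READING** (p. 432 *"Expanding these into random walks … implies immediately bounds and an exponential decay"*; the
summation of p. 410): if at `U` every term obeys the (3.99)-shape bound `|kterm(U; ω; y, y′)| ≤ walkFactor C c M δ |ω| d(ω,y,y′)` for `y, y′ ∈ Λ`, the
walk sets carry the length law, the exponential weights are counted by `KWalkCount … N₀ D₀ δ δ′`, `D₀cM⁻¹ ≤ ½`, and the kernel is dominated by the
partial sums, then `|Ck(U; y, y′)| ≤ 2N₀C·e^{−δ′dist(y,y′)}` for all `y, y′ ∈ Λ` — uniformly, by the geometric series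
(`B9Thm314WholeSummation.partialSum_walkFactorS_le`). [cite: Balaban1985BackgroundPropagators, Thm 3.15 (3.187) p.432, Cor. 3.8 proof p.410, Thm 3.9 (3.99) p.413] -/
theorem kernel_bound_of_reading {EC : RWKernelExpansion g B} {Ck : SiteKernel g B} {inΛ : g.Site → Prop}
    {W : ℕ → g.Site → g.Site → Finset EC.Walk} {U : B.Cfg} {dist : g.Site → g.Site → ℝ} {C c M δ N₀ D₀ δ' : ℝ}
    (hC : 0 ≤ C) (hc : 0 ≤ c) (hM : 0 < M) (hN₀ : 0 ≤ N₀) (hD₀ : 0 ≤ D₀) (hx : D₀ * (c * M ^ (-(1 : ℝ))) ≤ 1 / 2)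
    (hT : ∀ (ω : EC.Walk) (y y' : g.Site), inΛ y → inΛ y' →
      |EC.kterm U ω y y'| ≤ walkFactor C c M δ (EC.wlen ω) (EC.wdist ω y y'))
    (hW : ∀ (n : ℕ) (y y' : g.Site) (ω : EC.Walk), ω ∈ W n y y' → EC.wlen ω = n)
    (hcnt : KWalkCount EC W inΛ dist N₀ D₀ δ δ') (hread : KernelDominated EC Ck inΛ W U)
    {y y' : g.Site} (hy : inΛ y) (hy' : inΛ y') :
    |Ck.ker U y y'| ≤ 2 * N₀ * C * Real.exp (-(δ' * dist y y')) := by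
  refine hread y y' hy hy' _ fun m => ?_
  have hcM : 0 ≤ c * M ^ (-(1 : ℝ)) := mul_nonneg hc (Real.rpow_nonneg hM.le _)
  have hq : ∀ k, ∀ ω ∈ W k y y', |EC.kterm U ω y y'| ≤
      1 * walkFactorS C c M 1 δ (EC.wlen ω) (EC.wdist ω y y') * 1 * 1 := fun k ω _ => by
    rw [one_mul, mul_one, mul_one, ← walkFactor_eq_walkFactorS hM]
    exact hT ω y y' hy hy'
  calc ∑ k ∈ Finset.range m, ∑ ω ∈ W k y y', |EC.kterm U ω y y'|
      ≤ C * (2 * N₀) * 1 * Real.exp (-(δ' * dist y y')) * 1 * 1 :=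
        partialSum_walkFactorS_le (fun k => W k y y') (fun ω => |EC.kterm U ω y y'|) EC.wlen (fun ω => EC.wdist ω y y') hq
          (fun k ω hω => hW k y y' ω hω) (fun k => hcnt k y y' hy hy') zero_le_one hC zero_le_one zero_le_one hN₀ hD₀ hcM hx m
    _ = 2 * N₀ * C * Real.exp (-(δ' * dist y y')) := by ring

variable {d ℓ : ℕ} {hd : 1 ≤ d + 1} {hL : Odd (ℓ + 1) ∧ 1 < ℓ + 1} {b₀ b₁ : ℝ} {Mstar : ℕ}
variable {𝔸 : Type} [NormedRing 𝔸] [NormedAlgebra ℂ 𝔸] [CompleteSpace 𝔸] {G : Subgroup 𝔸ˣ}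

/-- `M = L·M_h > 0` at every member (`M_h ≥ 8`). [cite: Balaban1984PropagatorsII, (2.1)–(2.2) p.224, bookkeeping] -/
theorem geo9Y_M_pos (x : MemberY d ℓ hd hL b₀ b₁ Mstar) : 0 < (geo9Y x).M := by
  rw [geo9Y_M]
  have h8 : (8 : ℝ) ≤ (x.Mh : ℝ) := by exact_mod_cast x.hM8
  have hℓ : (0 : ℝ) < ((ℓ + 1 : ℕ) : ℝ) := by positivity
  exact mul_pos hℓ (by linarith)

/-- ★ **THE PINNED EXPANSION SLOT IS MONOTONE**: constants up (`C ≤ C′`, `c ≤ c′`), rate down (`δ′ ≤ δ`), for tree distances `d(ω, y, y′) ≥ 0` —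
`hasRWExpCY 𝔴 U δ` at the letter's own constants gives the (3.99)-shape bounds with `(C′, c′, δ′)`. [cite: Balaban1985BackgroundPropagators, Thm 3.15 p.432, Thm 3.9 (3.99) p.413, bookkeeping] -/
theorem kterm_le_of_hasRWExpCY {x : MemberY d ℓ hd hL b₀ b₁ Mstar} {𝔴 : RWLettersEY 𝔸 G x} {U : (bg9Y 𝔸 G x).Cfg} {δ δ' C' c' : ℝ}
    (h : hasRWExpCY 𝔴 U δ) (hδ : δ' ≤ δ) (hC : 𝔴.C ≤ C') (hc : 𝔴.c ≤ c')
    (hwd : ∀ (ω : 𝔴.EC.Walk) (y y' : (geo9Y x).Site), 0 ≤ 𝔴.EC.wdist ω y y')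
    (ω : 𝔴.EC.Walk) {y y' : (geo9Y x).Site} (hy : inΛY x y) (hy' : inΛY x y') :
    |𝔴.EC.kterm U ω y y'| ≤ walkFactor C' c' (geo9Y x).M δ' (𝔴.EC.wlen ω) (𝔴.EC.wdist ω y y') :=
  (h.2 ω y y' hy hy').2.trans
    (walkFactor_mono hC (𝔴.C_pos.le.trans hC) 𝔴.c_pos.le hc (geo9Y_M_pos x) hδ (hwd ω y y'))

/-- ★ **rate monotonicity of the pinned slot**: `hasRWExpCY 𝔴 U δ → hasRWExpCY 𝔴 U δ′` for `δ′ ≤ δ` (tree distances `≥ 0`).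
[cite: Balaban1985BackgroundPropagators, Thm 3.15 p.432, Thm 3.9 (3.99) p.413, bookkeeping] -/
theorem hasRWExpCY_mono {x : MemberY d ℓ hd hL b₀ b₁ Mstar} {𝔴 : RWLettersEY 𝔸 G x} {U : (bg9Y 𝔸 G x).Cfg} {δ δ' : ℝ}
    (hδ : δ' ≤ δ) (hwd : ∀ (ω : 𝔴.EC.Walk) (y y' : (geo9Y x).Site), 0 ≤ 𝔴.EC.wdist ω y y') (h : hasRWExpCY 𝔴 U δ) :
    hasRWExpCY 𝔴 U δ' :=
  ⟨h.1, fun ω y y' hy hy' => ⟨(h.2 ω y y' hy hy').1, kterm_le_of_hasRWExpCY h hδ le_rfl le_rfl hwd ω hy hy'⟩⟩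

variable (𝔸 G) in
/-- THE GUARD: at def-Y's FLAT walk letter `rwLettersEY_flat` (zero terms, `Converges := True`) the located reading FORCES THE KERNEL TO VANISH on Λ —
so the reading is not inhabited by the typing alone: it is junk-closable only through `C^{(k)}(Λ; U; y, y′) ≡ 0`, and carries content exactly with a
genuine walk letter. [cite: Balaban1985BackgroundPropagators, Thm 3.15 p.432, bookkeeping] -/
theorem ker_eq_zero_of_kernelDominated_flat (x : MemberY d ℓ hd hL b₀ b₁ Mstar) {Ck : SiteKernel (geo9Y x) (bg9Y 𝔸 G x)}
    {W : ℕ → (geo9Y x).Site → (geo9Y x).Site → Finset (rwLettersEY_flat 𝔸 G x).EC.Walk} {U : (bg9Y 𝔸 G x).Cfg}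
    (h : KernelDominated (rwLettersEY_flat 𝔸 G x).EC Ck (inΛY x) W U) {y y' : (geo9Y x).Site} (hy : inΛY x y) (hy' : inΛY x y') :
    Ck.ker U y y' = 0 := by
  have h0 : |Ck.ker U y y'| ≤ 0 := h y y' hy hy' 0 fun m => by
    refine le_of_eq (Finset.sum_eq_zero fun k _ => Finset.sum_eq_zero fun ω _ => ?_)
    show |(0 : ℝ)| = 0
    exact abs_zero
  exact abs_nonpos_iff.1 h0

end Summation

/-! ## §3 ROW 24 at the Sect. E layer `operatorLayerYSectE`, the bound (3.187) PROVED -/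

section Layer

variable {d ℓ : ℕ} {hd : 1 ≤ d + 1} {hL : Odd (ℓ + 1) ∧ 1 < ℓ + 1} {b₀ b₁ : ℝ} {Mstar : ℕ}
variable {𝔸 : Type} [NormedRing 𝔸] [NormedAlgebra ℂ 𝔸] [CompleteSpace 𝔸] {G : Subgroup 𝔸ˣ}

/-- ★★ **THEOREM 3.15 AS THE WHOLE PRINTED LEAF `B9.Thm315FullPrinted` AT THE SECT. E LAYER, THE BOUND (3.187) PROVED** (p. 432).  At every member the
layer is def-Y's `operatorLayerYSectE 𝔸 G x (ops x) (𝔏 x) (𝔢 x) (𝔴 x)` (`Ck` = the index-bond kernel reading of `C^{(k)}(Λ; U) = CkY x 𝔏 𝔢 U` defined by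
(3.156)–(3.158), `GivenBy3185 = givenBy3185Y`, `HasRWExpC = hasRWExpCY (𝔴 x)`).  DISPLAYED: `h` — under the printed prefix (every member, `0 < α₀`,
`Mα₀ ≤ a₀`, `U` in the classes (3.35)–(3.36)) the two pinned slots themselves, the (3.185) identity (print: from (3.159)–(3.184) and the positivity `γ₀ > 0`
of `C*Δ_kC`, p. 428; GAPS G-B9-09∕17) and the expansion clause at rate `δ₁` (G-B9-10); `hread` — the located reading (O2″) at every `U` where the walk
letter converges; the walk sets `W` with the length law `hW`, tree distances `≥ 0` (`hwd`), the count `hcnt` on Λ along `unitDistY` (rate `δ₁` in,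
`δ′ ≤ δ₁` out); uniform term constants `(𝔴 x).C ≤ C₀`, `(𝔴 x).c ≤ c₀` («depending on d and L only»); the floor `2D₀c₀ ≤ M⋆` («M sufficiently large»,
`mstar_le_M`).  OUTPUT: `δ₀ = δ′` (the slot at rate `δ′` by monotonicity), `a₀`, `B₀ = 2N₀C₀`; the conjunct (3.187) is DERIVED (`kernel_bound_of_reading`).
Nothing of print asserted; NOT a node discharge. [cite: Balaban1985BackgroundPropagators, Thm 3.15 (3.185)–(3.187) p.432, Thm 3.9 (3.98)–(3.99) p.413, Cor. 3.8 (3.91) p.410] -/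
theorem thm315FullPrinted_sectE_of_reading
    (ops : ∀ x : MemberY d ℓ hd hL b₀ b₁ Mstar, OperatorLayerY d ℓ hd hL b₀ b₁ Mstar 𝔸 G x)
    (𝔏 : ∀ x : MemberY d ℓ hd hL b₀ b₁ Mstar, CovLettersY 𝔸 x) (𝔢 : ∀ x : MemberY d ℓ hd hL b₀ b₁ Mstar, SectELettersY 𝔸 x)
    (𝔴 : ∀ x : MemberY d ℓ hd hL b₀ b₁ Mstar, RWLettersEY 𝔸 G x)
    {a₀ δ₁ δ' C₀ c₀ N₀ D₀ : ℝ} (ha₀ : 0 < a₀) (hδ' : 0 < δ') (hδ'₁ : δ' ≤ δ₁) (hC₀ : 0 < C₀) (hc₀ : 0 < c₀) (hN₀ : 0 < N₀)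
    (hD₀ : 0 < D₀) (hC : ∀ x, (𝔴 x).C ≤ C₀) (hc : ∀ x, (𝔴 x).c ≤ c₀)
    (W : ∀ x : MemberY d ℓ hd hL b₀ b₁ Mstar, ℕ → (geo9Y x).Site → (geo9Y x).Site → Finset (𝔴 x).EC.Walk)
    (hW : ∀ (x : MemberY d ℓ hd hL b₀ b₁ Mstar) (n : ℕ) (y y' : (geo9Y x).Site) (ω : (𝔴 x).EC.Walk), ω ∈ W x n y y' → (𝔴 x).EC.wlen ω = n)
    (hwd : ∀ (x : MemberY d ℓ hd hL b₀ b₁ Mstar) (ω : (𝔴 x).EC.Walk) (y y' : (geo9Y x).Site), 0 ≤ (𝔴 x).EC.wdist ω y y')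
    (hcnt : ∀ x : MemberY d ℓ hd hL b₀ b₁ Mstar, KWalkCount (𝔴 x).EC (W x) (inΛY x) (unitDistY x) N₀ D₀ δ₁ δ')
    (hM : 2 * D₀ * c₀ ≤ (Mstar : ℝ))
    (h : ∀ (x : MemberY d ℓ hd hL b₀ b₁ Mstar) (α₀ : ℝ), 0 < α₀ → (geo9Y x).M * α₀ ≤ a₀ →
      ∀ U : (bg9Y 𝔸 G x).Cfg, (bg9Y 𝔸 G x).Reg335 c35Y α₀ U → (bg9Y 𝔸 G x).Reg336 c35Y α₀ U →
        givenBy3185Y x (𝔏 x) (𝔢 x) U ∧ hasRWExpCY (𝔴 x) U δ₁)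
    (hread : ∀ (x : MemberY d ℓ hd hL b₀ b₁ Mstar) (U : (bg9Y 𝔸 G x).Cfg), (𝔴 x).EC.Converges U →
      KernelDominated (𝔴 x).EC (siteKernelOfOp x.toKIdx (bg9Y 𝔸 G x) (fun U => U) (CkY x (𝔏 x) (𝔢 x)) id id) (inΛY x) (W x) U) :
    B9.Thm315FullPrinted c35Y geo9Y (bg9Y 𝔸 G)
      (fun x => (operatorLayerYSectE 𝔸 G x (ops x) (𝔏 x) (𝔢 x) (𝔴 x)).Ck) inΛY unitDistY
      (fun x => (operatorLayerYSectE 𝔸 G x (ops x) (𝔏 x) (𝔢 x) (𝔴 x)).GivenBy3185)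
      (fun x => (operatorLayerYSectE 𝔸 G x (ops x) (𝔏 x) (𝔢 x) (𝔴 x)).HasRWExpC) := by
  refine ⟨δ', a₀, 2 * N₀ * C₀, hδ', ha₀, by positivity, fun x α₀ hα hMa U hU hU' => ?_⟩
  obtain ⟨h85, hRW⟩ := h x α₀ hα hMa U hU hU'
  have hMpos : 0 < (geo9Y x).M := geo9Y_M_pos x
  refine ⟨h85, hasRWExpCY_mono hδ'₁ (hwd x) hRW, fun y y' hy hy' => ?_⟩
  have hx : D₀ * (c₀ * (geo9Y x).M ^ (-(1 : ℝ))) ≤ 1 / 2 := half_threshold hMpos (hM.trans (mstar_le_M x))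
  exact kernel_bound_of_reading hC₀.le hc₀.le hMpos hN₀.le hD₀.le hx
    (fun ω z z' hz hz' => kterm_le_of_hasRWExpCY hRW le_rfl (hC x) (hc x) (hwd x) ω hz hz')
    (hW x) (hcnt x) (hread x U hRW.1) hy hy'

/-- The bound-only leaf of unit r1 (`B9.Thm315Printed`, (3.187) alone) at the same data, by `B9.thm315_bound_of_full`.
[cite: Balaban1985BackgroundPropagators, Thm 3.15 (3.187) p.432] -/
theorem thm315Printed_sectE_of_reading
    (ops : ∀ x : MemberY d ℓ hd hL b₀ b₁ Mstar, OperatorLayerY d ℓ hd hL b₀ b₁ Mstar 𝔸 G x)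
    (𝔏 : ∀ x : MemberY d ℓ hd hL b₀ b₁ Mstar, CovLettersY 𝔸 x) (𝔢 : ∀ x : MemberY d ℓ hd hL b₀ b₁ Mstar, SectELettersY 𝔸 x)
    (𝔴 : ∀ x : MemberY d ℓ hd hL b₀ b₁ Mstar, RWLettersEY 𝔸 G x)
    {a₀ δ₁ δ' C₀ c₀ N₀ D₀ : ℝ} (ha₀ : 0 < a₀) (hδ' : 0 < δ') (hδ'₁ : δ' ≤ δ₁) (hC₀ : 0 < C₀) (hc₀ : 0 < c₀) (hN₀ : 0 < N₀)
    (hD₀ : 0 < D₀) (hC : ∀ x, (𝔴 x).C ≤ C₀) (hc : ∀ x, (𝔴 x).c ≤ c₀)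
    (W : ∀ x : MemberY d ℓ hd hL b₀ b₁ Mstar, ℕ → (geo9Y x).Site → (geo9Y x).Site → Finset (𝔴 x).EC.Walk)
    (hW : ∀ (x : MemberY d ℓ hd hL b₀ b₁ Mstar) (n : ℕ) (y y' : (geo9Y x).Site) (ω : (𝔴 x).EC.Walk), ω ∈ W x n y y' → (𝔴 x).EC.wlen ω = n)
    (hwd : ∀ (x : MemberY d ℓ hd hL b₀ b₁ Mstar) (ω : (𝔴 x).EC.Walk) (y y' : (geo9Y x).Site), 0 ≤ (𝔴 x).EC.wdist ω y y')
    (hcnt : ∀ x : MemberY d ℓ hd hL b₀ b₁ Mstar, KWalkCount (𝔴 x).EC (W x) (inΛY x) (unitDistY x) N₀ D₀ δ₁ δ')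
    (hM : 2 * D₀ * c₀ ≤ (Mstar : ℝ))
    (h : ∀ (x : MemberY d ℓ hd hL b₀ b₁ Mstar) (α₀ : ℝ), 0 < α₀ → (geo9Y x).M * α₀ ≤ a₀ →
      ∀ U : (bg9Y 𝔸 G x).Cfg, (bg9Y 𝔸 G x).Reg335 c35Y α₀ U → (bg9Y 𝔸 G x).Reg336 c35Y α₀ U →
        givenBy3185Y x (𝔏 x) (𝔢 x) U ∧ hasRWExpCY (𝔴 x) U δ₁)
    (hread : ∀ (x : MemberY d ℓ hd hL b₀ b₁ Mstar) (U : (bg9Y 𝔸 G x).Cfg), (𝔴 x).EC.Converges U →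
      KernelDominated (𝔴 x).EC (siteKernelOfOp x.toKIdx (bg9Y 𝔸 G x) (fun U => U) (CkY x (𝔏 x) (𝔢 x)) id id) (inΛY x) (W x) U) :
    B9.Thm315Printed c35Y geo9Y (bg9Y 𝔸 G)
      (fun x => (operatorLayerYSectE 𝔸 G x (ops x) (𝔏 x) (𝔢 x) (𝔴 x)).Ck) inΛY unitDistY :=
  B9.thm315_bound_of_full c35Y geo9Y (bg9Y 𝔸 G) _ inΛY unitDistY _ _
    (thm315FullPrinted_sectE_of_reading ops 𝔏 𝔢 𝔴 ha₀ hδ' hδ'₁ hC₀ hc₀ hN₀ hD₀ hC hc W hW hwd hcnt hM h hread)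

end Layer

/-! ## §4 Record level (`𝔸 = M_N(ℂ)`, `G = SU(N)`): ROW 24 at `opsYSectE` and at the instance of record `opsYOfRecordES` -/

section Record

open scoped Matrix.Norms.L2Operator

variable (N : ℕ) (θ : Stage3Params) (Mstar : ℕ)

/-- ★★ **ROW 24 (`t315`) OF THE N06 CERTIFICATE AT THE SECT. E LAYER FAMILY `opsYSectE N θ M⋆ ops 𝔏 𝔢 𝔴`** (generic base family `ops` and letters
`𝔏`), the bound (3.187) PROVED: §3 at `M_N(ℂ)`, `SU(N)`.  The displayed hypotheses are those of `thm315FullPrinted_sectE_of_reading`.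
[cite: Balaban1985BackgroundPropagators, Thm 3.15 (3.185)–(3.187) p.432, Thm 3.9 (3.98)–(3.99) p.413, Cor. 3.8 (3.91) p.410] -/
theorem t315_opsYSectE_of_reading (ops : OpsY N θ Mstar) (𝔏 : LettersY N θ Mstar) (𝔢 : SectEY N θ Mstar) (𝔴 : RWEY N θ Mstar)
    {a₀ δ₁ δ' C₀ c₀ N₀ D₀ : ℝ} (ha₀ : 0 < a₀) (hδ' : 0 < δ') (hδ'₁ : δ' ≤ δ₁) (hC₀ : 0 < C₀) (hc₀ : 0 < c₀) (hN₀ : 0 < N₀)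
    (hD₀ : 0 < D₀) (hC : ∀ x, (𝔴 x).C ≤ C₀) (hc : ∀ x, (𝔴 x).c ≤ c₀)
    (W : ∀ x : MemberY θ.d₆ θ.ℓ₆ θ.hd' θ.hL' θ.b₀ θ.b₁ Mstar, ℕ → (geo9Y x).Site → (geo9Y x).Site → Finset (𝔴 x).EC.Walk)
    (hW : ∀ (x : MemberY θ.d₆ θ.ℓ₆ θ.hd' θ.hL' θ.b₀ θ.b₁ Mstar) (n : ℕ) (y y' : (geo9Y x).Site) (ω : (𝔴 x).EC.Walk),
      ω ∈ W x n y y' → (𝔴 x).EC.wlen ω = n)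
    (hwd : ∀ (x : MemberY θ.d₆ θ.ℓ₆ θ.hd' θ.hL' θ.b₀ θ.b₁ Mstar) (ω : (𝔴 x).EC.Walk) (y y' : (geo9Y x).Site), 0 ≤ (𝔴 x).EC.wdist ω y y')
    (hcnt : ∀ x : MemberY θ.d₆ θ.ℓ₆ θ.hd' θ.hL' θ.b₀ θ.b₁ Mstar, KWalkCount (𝔴 x).EC (W x) (inΛY x) (unitDistY x) N₀ D₀ δ₁ δ')
    (hM : 2 * D₀ * c₀ ≤ (Mstar : ℝ))
    (h : ∀ (x : MemberY θ.d₆ θ.ℓ₆ θ.hd' θ.hL' θ.b₀ θ.b₁ Mstar) (α₀ : ℝ), 0 < α₀ → (geo9Y x).M * α₀ ≤ a₀ →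
      ∀ U : (bg9Y (Matrix (Fin N) (Fin N) ℂ) (specialUnitaryUnits (Fin N)) x).Cfg,
        (bg9Y (Matrix (Fin N) (Fin N) ℂ) (specialUnitaryUnits (Fin N)) x).Reg335 c35Y α₀ U →
        (bg9Y (Matrix (Fin N) (Fin N) ℂ) (specialUnitaryUnits (Fin N)) x).Reg336 c35Y α₀ U →
          givenBy3185Y x (𝔏 x) (𝔢 x) U ∧ hasRWExpCY (𝔴 x) U δ₁)
    (hread : ∀ (x : MemberY θ.d₆ θ.ℓ₆ θ.hd' θ.hL' θ.b₀ θ.b₁ Mstar) (U : (bg9Y (Matrix (Fin N) (Fin N) ℂ) (specialUnitaryUnits (Fin N)) x).Cfg),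
      (𝔴 x).EC.Converges U →
        KernelDominated (𝔴 x).EC (siteKernelOfOp x.toKIdx (bg9Y (Matrix (Fin N) (Fin N) ℂ) (specialUnitaryUnits (Fin N)) x) (fun U => U)
          (CkY x (𝔏 x) (𝔢 x)) id id) (inΛY x) (W x) U) :
    B9.Thm315FullPrinted c35Y geo9Y (bg9Y (Matrix (Fin N) (Fin N) ℂ) (specialUnitaryUnits (Fin N)))
      (fun x => (opsYSectE N θ Mstar ops 𝔏 𝔢 𝔴 x).Ck) inΛY unitDistY
      (fun x => (opsYSectE N θ Mstar ops 𝔏 𝔢 𝔴 x).GivenBy3185) (fun x => (opsYSectE N θ Mstar ops 𝔏 𝔢 𝔴 x).HasRWExpC) :=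
  thm315FullPrinted_sectE_of_reading ops 𝔏 𝔢 𝔴 ha₀ hδ' hδ'₁ hC₀ hc₀ hN₀ hD₀ hC hc W hW hwd hcnt hM h hread

/-- ★★ **ROW 24 (`t315`) OF THE N06 CERTIFICATE AT THE INSTANCE OF RECORD `opsYOfRecordES N θ M⋆ 𝔯 𝔢 𝔴 𝔈`** — the binder VERBATIM (the left-hand side
of def-Y's `t315_opsYOfRecordES_iff`), the bound (3.187) PROVED.  For dag-n06-d's E re-instantiation: the whole named binder is replaced by the two
pinned slots on the printed prefix (`h`), the located reading (`hread`, (O2″)), the walk data (`W hW hwd hcnt`), uniform term constants and the floor.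
[cite: Balaban1985BackgroundPropagators, Thm 3.15 (3.185)–(3.187) p.432, Thm 3.9 (3.98)–(3.99) p.413, Cor. 3.8 (3.91) p.410] -/
theorem t315_opsYOfRecordES_of_reading (𝔯 : ResY N θ Mstar) (𝔢 : SectEY N θ Mstar) (𝔴 : RWEY N θ Mstar) (𝔈 : ExpsY N θ Mstar)
    {a₀ δ₁ δ' C₀ c₀ N₀ D₀ : ℝ} (ha₀ : 0 < a₀) (hδ' : 0 < δ') (hδ'₁ : δ' ≤ δ₁) (hC₀ : 0 < C₀) (hc₀ : 0 < c₀) (hN₀ : 0 < N₀)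
    (hD₀ : 0 < D₀) (hC : ∀ x, (𝔴 x).C ≤ C₀) (hc : ∀ x, (𝔴 x).c ≤ c₀)
    (W : ∀ x : MemberY θ.d₆ θ.ℓ₆ θ.hd' θ.hL' θ.b₀ θ.b₁ Mstar, ℕ → (geo9Y x).Site → (geo9Y x).Site → Finset (𝔴 x).EC.Walk)
    (hW : ∀ (x : MemberY θ.d₆ θ.ℓ₆ θ.hd' θ.hL' θ.b₀ θ.b₁ Mstar) (n : ℕ) (y y' : (geo9Y x).Site) (ω : (𝔴 x).EC.Walk),
      ω ∈ W x n y y' → (𝔴 x).EC.wlen ω = n)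
    (hwd : ∀ (x : MemberY θ.d₆ θ.ℓ₆ θ.hd' θ.hL' θ.b₀ θ.b₁ Mstar) (ω : (𝔴 x).EC.Walk) (y y' : (geo9Y x).Site), 0 ≤ (𝔴 x).EC.wdist ω y y')
    (hcnt : ∀ x : MemberY θ.d₆ θ.ℓ₆ θ.hd' θ.hL' θ.b₀ θ.b₁ Mstar, KWalkCount (𝔴 x).EC (W x) (inΛY x) (unitDistY x) N₀ D₀ δ₁ δ')
    (hM : 2 * D₀ * c₀ ≤ (Mstar : ℝ))
    (h : ∀ (x : MemberY θ.d₆ θ.ℓ₆ θ.hd' θ.hL' θ.b₀ θ.b₁ Mstar) (α₀ : ℝ), 0 < α₀ → (geo9Y x).M * α₀ ≤ a₀ →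
      ∀ U : (bg9Y (Matrix (Fin N) (Fin N) ℂ) (specialUnitaryUnits (Fin N)) x).Cfg,
        (bg9Y (Matrix (Fin N) (Fin N) ℂ) (specialUnitaryUnits (Fin N)) x).Reg335 c35Y α₀ U →
        (bg9Y (Matrix (Fin N) (Fin N) ℂ) (specialUnitaryUnits (Fin N)) x).Reg336 c35Y α₀ U →
          givenBy3185Y x (lettersYOfRecordDE N θ Mstar 𝔯 x) (𝔢 x) U ∧ hasRWExpCY (𝔴 x) U δ₁)
    (hread : ∀ (x : MemberY θ.d₆ θ.ℓ₆ θ.hd' θ.hL' θ.b₀ θ.b₁ Mstar) (U : (bg9Y (Matrix (Fin N) (Fin N) ℂ) (specialUnitaryUnits (Fin N)) x).Cfg),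
      (𝔴 x).EC.Converges U →
        KernelDominated (𝔴 x).EC (siteKernelOfOp x.toKIdx (bg9Y (Matrix (Fin N) (Fin N) ℂ) (specialUnitaryUnits (Fin N)) x) (fun U => U)
          (CkY x (lettersYOfRecordDE N θ Mstar 𝔯 x) (𝔢 x)) id id) (inΛY x) (W x) U) :
    B9.Thm315FullPrinted c35Y geo9Y (bg9Y (Matrix (Fin N) (Fin N) ℂ) (specialUnitaryUnits (Fin N)))
      (fun x => (opsYOfRecordES N θ Mstar 𝔯 𝔢 𝔴 𝔈 x).Ck) inΛY unitDistY
      (fun x => (opsYOfRecordES N θ Mstar 𝔯 𝔢 𝔴 𝔈 x).GivenBy3185) (fun x => (opsYOfRecordES N θ Mstar 𝔯 𝔢 𝔴 𝔈 x).HasRWExpC) :=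
  t315_opsYSectE_of_reading N θ Mstar (B9Ineq349SiteReading.opsYS349OfRecordDE N θ Mstar 𝔯 𝔈) (lettersYOfRecordDE N θ Mstar 𝔯) 𝔢 𝔴
    ha₀ hδ' hδ'₁ hC₀ hc₀ hN₀ hD₀ hC hc W hW hwd hcnt hM h hread

end Record

end Literature.MathematicalPhysics.QuantumFieldTheory.Balaban1983to89.B9Thm315WholeSectE
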